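import Literature.NumberTheory.Sieve.LinearEquationsInPrimesNormalFormExtension
import Literature.NumberTheory.Sieve.LinearEquationsInPrimesCrudeBounds
import Literature.NumberTheory.Sieve.ConvexBodyLatticePoints
import Mathlib.Analysis.SpecialFunctions.Pow.Real
import HarnessLib

/-!
# Linear equations in primes: the linear-algebra reductions of §4, assembled (Green–Tao 2010)

Trunk T-SIEVE (`Literature/NumberTheory/Sieve`). B. Green, T. Tao, *Linear equations in primes*,
Ann. of Math. 171 (2010), §4 ("Linear algebra reductions") reduces the Main Theorem to
Thm. 4.5 (primes in affine lattices in `s`-normal form) in two moves: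

* *Elimination of the archimedean factor* (reduction to Thm. 4.1): intersect `K` with
  `Ψ⁻¹((ℝ⁺)ᵗ)` (then `β_∞ = vol K`), use the lattice point count (1.3)/(A.1)
  `#(K ∩ ℤ^d) = vol(K) + O(N^{d-1})` and the boundedness of `∏_p β_p`, and discard the region
  `0 ≤ ψᵢ ≤ N^{9/10}` "estimating `Λ` crudely by `log N`";
* *Normal form reduction* ("Proof of the Main Theorem assuming Theorem 4.5"): pass to the
  normal form extension `Ψ'(n, m) = Ψ(n + ∑ mₗ fₗ)` of Lemma 4.4 on `ℤ^{d'}`, for which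
  `β'_p = β_p`, with the body `K' = {(n, m) ∈ ℝ^d × [-N,N]^{d'-d} : n + ∑ mₗ fₗ ∈ K} ⊆
  [-N',N']^{d'}`, `N' = O(N)`, apply Thm. 4.5, change variables `r := n + ∑ mₗ fₗ` and divide by
  `(2N+1)^{d'-d}`.

All the ingredients were proved in the sibling files (`…NormalFormExtension`: Lemma 4.4, `β'_q =
β_q`, the change of variables; `…CrudeBounds`: the slab `0 < ψᵢ ≤ H`; `…SingularSeries`:
`0 ≤ ∏_p β_p ≤ B(t, L)`; `ConvexBodyLatticePoints`: (A.1)). This file assembles them into the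
**discharge** `Literature.NumberTheory.Sieve.GreenTao2010_main_of_mainNormalForm_holds` of the named fact
`Literature.NumberTheory.Sieve.GreenTao2010_main_of_mainNormalForm` (`LinearEquationsInPrimesNormalForm.lean`): the
level-`s` normal-form statements (conclusion of Thm. 4.5) for all `s ≥ 1` imply the generalised
Hardy–Littlewood asymptotic for every system of finite complexity. Consequently
(`Literature.NumberTheory.Sieve.GreenTao2010_transference_of_wTricked`) the transference
`GreenTao2010_transference` now rests on the two remaining printed reductions (§5: Thm. 4.5 from
Thm. 5.1; §7: Thm. 5.2 from Thm. 7.2) only.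

## The proof (as printed, with explicit constants)

Given `d, t, L` and `ε`, put `k = t²`, `C = 1 + 2kL`, `s = max(1, t - 2)` (Lemma 1.6: finite
complexity means complexity `≤ t - 2`; "the case `s = 0` follows from the `s = 1` case", an
`(t-2)`-normal form being an `s`-normal form). For `Ψ` of finite complexity with `‖Ψ‖_N ≤ L` and
convex `K ⊆ [-N,N]^d` let `N' = CN`, `H = ⌈N'^{8/10}⌉`, `K_H = K ∩ {ψᵢ > H ∀ i}`,
`K₀ = K ∩ {ψᵢ > 0 ∀ i}`, `S = ∏_p β_p ∈ [0, B]`. Then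
`Σ_K - β_∞ S = (Σ_K - Σ_{K_H}) + (Σ_{K_H} - #K_H S) + (#K_H - #K₀) S + (#K₀ - vol K₀) S` and
* `0 ≤ Σ_K - Σ_{K_H} ≤ t H (2N+1)^{d-1} log^t(2LN)` and `0 ≤ #K₀ - #K_H ≤ t H (2N+1)^{d-1}`
  (`…CrudeBounds`);
* `|#K₀ - vol K₀| ≤ C_d N^{d-1}` (App. A), `β_∞ = vol K₀`;
* Thm. 4.5 at level `s`, dimension `d + k`, scale `N'`, size `L' = t(d+k)(L + 2dL²) + L`,
  tolerance `ε / (4 C^{d+k})`, applied to `Ψ'` and `K' = extBody f N K_H` (on which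
  `ψ'ᵢ > H ≥ N'^{8/10}`), gives after the change of variables
  `(2N+1)^k |Σ_{K_H} - #K_H S| ≤ (ε/4C^{d+k}) (CN)^{d+k} ≤ (ε/4) N^d (2N+1)^k`;
* the three crude terms are `O(N^{d - 1/5} log^t N) ≤ (ε/4) N^d` for `N` large
  (`Literature.NumberTheory.Sieve.slab_error_eventually`).

## References

* B. Green, T. Tao, *Linear equations in primes*, Ann. of Math. (2) 171 (2010), 1753–1850
  (arXiv:math/0606088): §4 — "Elimination of the archimedean factor", Thm. 4.1, Def. 4.2,
  Def. 4.3, Lemma 4.4, Thm. 4.5, "Proof of the Main Theorem assuming Theorem 4.5"; Lemma 1.6;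
  (1.3) and App. A.
-/

noncomputable section

open Filter Finset MeasureTheory
open scoped Topology

namespace Literature.NumberTheory.Sieve

variable {d t k : ℕ}

/-! ### The singular product and the size of an extension -/

/-- `∏_{p ≤ x} β'_p = ∏_{p ≤ x} β_p` for the extension `Ψ'(n, m) = Ψ(n + ∑ mₗ fₗ)`
(`localFactor_extendAlong`). [cite: GreenTao2010, §4 (Proof of the Main Theorem assuming
Theorem 4.5: "the local factors `β'_p` … are precisely the same as the local factors `β_p`")] -/
theorem singularProductPartial_extendAlong (Ψ : Fin t → AffLinForm d) (f : Fin k → Fin d → ℤ)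
    (x : ℕ) :
    singularProductPartial (fun i => (Ψ i).extendAlong f) x = singularProductPartial Ψ x := by
  unfold singularProductPartial
  refine Finset.prod_congr rfl fun p hp => ?_
  haveI : NeZero p := ⟨(Nat.prime_of_mem_primesLE hp).ne_zero⟩
  exact localFactor_extendAlong Ψ f p

/-- `∏_p β'_p = ∏_p β_p` for the extension `Ψ'(n, m) = Ψ(n + ∑ mₗ fₗ)`.
[cite: GreenTao2010, §4 (Proof of the Main Theorem assuming Theorem 4.5)] -/
theorem singularProduct_extendAlong (Ψ : Fin t → AffLinForm d) (f : Fin k → Fin d → ℤ) :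
    singularProduct (fun i => (Ψ i).extendAlong f) = singularProduct Ψ := by
  unfold singularProduct
  rw [show singularProductPartial (fun i => (Ψ i).extendAlong f) = singularProductPartial Ψ from
    funext (singularProductPartial_extendAlong Ψ f)]

/-- "If the original system `Ψ` had size `‖Ψ‖_N = O(1)`, then the same is true of the extended
system `Ψ'`" (Lemma 4.4), quantitatively: if `‖Ψ‖_N ≤ L`, the vectors `fₗ` have entries
`≤ M` in absolute value and `N' ≥ N > 0`, then `‖Ψ'‖_{N'} ≤ t (d + k) (L + d L M) + L`.
[cite: GreenTao2010, Lemma 4.4] -/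
theorem affLinSize_extendAlong_le {Ψ : Fin t → AffLinForm d} {L M : ℕ} {N N' : ℝ} (hN : 0 < N)
    (hNN' : N ≤ N') (hL : affLinSize Ψ N ≤ L) {f : Fin k → Fin d → ℤ}
    (hM : ∀ l j, (f l j).natAbs ≤ M) :
    affLinSize (fun i => (Ψ i).extendAlong f) N' ≤ ((t * (d + k) * (L + d * L * M) + L : ℕ) : ℝ) := by
  have hcoef : ∀ i j, ((Ψ i).coeff j).natAbs ≤ L := fun i j =>
    natAbs_coeff_le_of_affLinSize_le hL i j
  have hN'0 : 0 < N' := hN.trans_le hNN'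
  unfold affLinSize
  push_cast
  refine add_le_add ?_ ?_
  · calc ∑ i, ∑ x, |(((Ψ i).extendAlong f).coeff x : ℝ)|
        ≤ ∑ _i : Fin t, ∑ _x : Fin (d + k), ((L : ℝ) + d * L * M) :=
          Finset.sum_le_sum fun i _ => Finset.sum_le_sum fun x _ => by
            have h1 := natAbs_coeff_extendAlong_le hcoef hM i x
            have h2 : ((((Ψ i).extendAlong f).coeff x).natAbs : ℝ) ≤ ((L + d * L * M : ℕ) : ℝ) := by
              exact_mod_cast h1
            rw [Nat.cast_natAbs, Int.cast_abs] at h2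
            push_cast at h2
            exact h2
      _ = t * (d + k) * (L + d * L * M) := by
          simp only [Finset.sum_const, Finset.card_univ, Fintype.card_fin, nsmul_eq_mul]
          push_cast
          ring
  · calc ∑ i, |(((Ψ i).extendAlong f).const : ℝ) / N'|
        ≤ ∑ i, |((Ψ i).const : ℝ) / N| := Finset.sum_le_sum fun i _ => by
          rw [AffLinForm.extendAlong_const, abs_div, abs_div, abs_of_pos hN, abs_of_pos hN'0]
          exact div_le_div_of_nonneg_left (abs_nonneg _) hN hNN'
      _ ≤ L := le_trans (le_add_of_nonneg_left
          (Finset.sum_nonneg fun _ _ => Finset.sum_nonneg fun _ _ => abs_nonneg _)) hL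

/-- The lattice point count is monotone in the body. [folklore] -/
theorem latticePointCount_mono {K K' : Set (Fin d → ℝ)} (h : K ⊆ K') (N : ℕ) :
    latticePointCount K N ≤ latticePointCount K' N := by
  classical
  unfold latticePointCount
  exact Finset.card_le_card (Finset.monotone_filter_right _ fun n _ hn => h hn)

/-- `0 ≤ ∏_p β_p ≤ B(t, L)` for systems of finite complexity with coefficients bounded by `L`
("the product `∏_p β_p` is either zero or comparable to `1`" / "the boundedness of the product
`∏_p β_p`"): the partial products lie in `[0, B]` (`singularProductPartial_le_uniform`) and
converge to `∏_p β_p` (Lemma 1.3, `tendsto_singularProductPartial_holds`).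
[cite: GreenTao2010, Remark after Lemma 1.6 and §4 (Elimination of the archimedean factor)] -/
theorem singularProduct_mem_Icc_uniform (t L : ℕ) : ∃ B : ℝ, 0 ≤ B ∧
    ∀ (d : ℕ) (Ψ : Fin t → AffLinForm d), IsNondegenerateSystem Ψ →
      IsFiniteComplexitySystem Ψ → (∀ i j, ((Ψ i).coeff j).natAbs ≤ L) →
        0 ≤ singularProduct Ψ ∧ singularProduct Ψ ≤ B := by
  obtain ⟨B, hB0, hB⟩ := singularProductPartial_le_uniform t L
  refine ⟨B, hB0, fun d Ψ hΨ hfc hL => ?_⟩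
  have hT := tendsto_singularProductPartial_holds d t Ψ hΨ
  exact ⟨ge_of_tendsto' hT fun w => (hB d Ψ hΨ hfc hL w).1,
    le_of_tendsto' hT fun w => (hB d Ψ hΨ hfc hL w).2⟩

/-! ### The crude error terms are `o(N^d)` -/

/-- The error terms of the archimedean reduction are `o(N^d)`: for `A, L ≥ 1`, `ε > 0`, `d ≥ 1`,
eventually `A ((A N)^{8/10} + 1) (2N+1)^{d-1} (1 + log(2LN))^t ≤ ε N^d` (the left side is
`O(N^{d - 1/10})`: bound `1 + log(2LN) ≤ 2L(1 + 1/δ) N^δ` with `δ = 1/(10(t+1))`).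
[cite: GreenTao2010, §4 ("the contribution of the case `0 ≤ ψᵢ(n) ≤ N^{9/10}` to (4.2) is
`o(N^d)`")] -/
theorem slab_error_eventually {A L ε : ℝ} (hA : 1 ≤ A) (hL : 1 ≤ L) (hε : 0 < ε) (d t : ℕ)
    (hd : 1 ≤ d) : ∃ N₀ : ℕ, ∀ N : ℕ, N₀ ≤ N →
      A * ((A * N) ^ ((8 : ℝ) / 10) + 1) * (2 * N + 1) ^ (d - 1) * (1 + Real.log (2 * L * N)) ^ t ≤
        ε * (N : ℝ) ^ d := by
  -- constants
  set δ : ℝ := 1 / (10 * (t + 1)) with hδ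
  have hδ0 : 0 < δ := by positivity
  have hδt : δ * t ≤ 1 / 10 := by
    rw [hδ, div_mul_eq_mul_div, one_mul, div_le_div_iff₀ (by positivity) (by norm_num)]
    have : (t : ℝ) ≤ t + 1 := by linarith
    nlinarith
  set C₂ : ℝ := 2 * A ^ 2 * 3 ^ (d - 1) * (2 * L * (1 + 1 / δ)) ^ t with hC₂
  have hC₂0 : 0 < C₂ := by positivity
  refine ⟨⌈(C₂ / ε) ^ (10 : ℕ)⌉₊ + 1, fun N hN => ?_⟩
  have hN1 : (1 : ℝ) ≤ N := by exact_mod_cast (by omega : 1 ≤ N)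
  have hN0 : (0 : ℝ) < N := by linarith
  set n : ℝ := (N : ℝ) with hn
  -- (1) `(A n)^θ + 1 ≤ 2 A n^θ`
  have h1 : (A * n) ^ ((8 : ℝ) / 10) + 1 ≤ 2 * A * n ^ ((8 : ℝ) / 10) := by
    have ha : (A * n) ^ ((8 : ℝ) / 10) ≤ A * n ^ ((8 : ℝ) / 10) := by
      rw [Real.mul_rpow (by linarith) hN0.le]
      exact mul_le_mul_of_nonneg_right (Real.rpow_le_self_of_one_le hA (by norm_num))
        (Real.rpow_nonneg hN0.le _)
    have hb : 1 ≤ A * n ^ ((8 : ℝ) / 10) :=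
      one_le_mul_of_one_le_of_one_le hA (Real.one_le_rpow hN1 (by norm_num))
    linarith
  -- (2) `(2n+1)^{d-1} ≤ 3^{d-1} n^{d-1}`
  have h2 : (2 * n + 1) ^ (d - 1) ≤ (3 : ℝ) ^ (d - 1) * n ^ (d - 1) := by
    rw [← mul_pow]
    exact pow_le_pow_left₀ (by linarith) (by linarith) _
  -- (3) `1 + log(2Ln) ≤ 2L(1 + 1/δ) n^δ`
  have h3 : 1 + Real.log (2 * L * n) ≤ 2 * L * (1 + 1 / δ) * n ^ δ := by
    have h2Ln : (1 : ℝ) ≤ 2 * L * n := by nlinarith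
    have hlog := Real.log_le_rpow_div (by linarith : (0 : ℝ) ≤ 2 * L * n) hδ0
    have hpow : (2 * L * n) ^ δ ≤ 2 * L * n ^ δ := by
      rw [Real.mul_rpow (by linarith) hN0.le]
      exact mul_le_mul_of_nonneg_right
        (Real.rpow_le_self_of_one_le (by linarith)
          (by rw [hδ]; exact (div_le_one (by positivity)).mpr (by nlinarith)))
        (Real.rpow_nonneg hN0.le _)
    have hone : 1 ≤ 2 * L * n ^ δ :=
      one_le_mul_of_one_le_of_one_le (by linarith) (Real.one_le_rpow hN1 hδ0.le)
    calc 1 + Real.log (2 * L * n) ≤ 1 + (2 * L * n) ^ δ / δ := by linarith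
      _ ≤ 2 * L * n ^ δ + (2 * L * n ^ δ) / δ := by
          gcongr
      _ = 2 * L * (1 + 1 / δ) * n ^ δ := by ring
  have h3t : (1 + Real.log (2 * L * n)) ^ t ≤ (2 * L * (1 + 1 / δ)) ^ t * n ^ (δ * t) := by
    have hlog0 : 0 ≤ 1 + Real.log (2 * L * n) := by
      have : 0 ≤ Real.log (2 * L * n) := Real.log_nonneg (by nlinarith)
      linarith
    calc (1 + Real.log (2 * L * n)) ^ t ≤ (2 * L * (1 + 1 / δ) * n ^ δ) ^ t :=
          pow_le_pow_left₀ hlog0 h3 t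
      _ = (2 * L * (1 + 1 / δ)) ^ t * n ^ (δ * t) := by
          rw [mul_pow, Real.rpow_mul hN0.le, Real.rpow_natCast]
  -- (4) combine: LHS ≤ C₂ n^{8/10 + (d-1) + δ t}
  have hθ : (8 : ℝ) / 10 + ((d - 1 : ℕ) : ℝ) + δ * t ≤ (d : ℝ) - 1 / 10 := by
    have : ((d - 1 : ℕ) : ℝ) = (d : ℝ) - 1 := by
      rw [Nat.cast_sub hd, Nat.cast_one]
    rw [this]
    linarith
  have hlog0 : 0 ≤ 1 + Real.log (2 * L * n) := by
    have : 0 ≤ Real.log (2 * L * n) := Real.log_nonneg (by nlinarith)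
    linarith
  have hLHS : A * ((A * n) ^ ((8 : ℝ) / 10) + 1) * (2 * n + 1) ^ (d - 1) *
      (1 + Real.log (2 * L * n)) ^ t ≤ C₂ * n ^ ((d : ℝ) - 1 / 10) := by
    have hA0 : 0 ≤ A := by linarith
    have step : A * ((A * n) ^ ((8 : ℝ) / 10) + 1) * (2 * n + 1) ^ (d - 1) *
        (1 + Real.log (2 * L * n)) ^ t ≤
        A * (2 * A * n ^ ((8 : ℝ) / 10)) * ((3 : ℝ) ^ (d - 1) * n ^ (d - 1)) *
          ((2 * L * (1 + 1 / δ)) ^ t * n ^ (δ * t)) :=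
      mul_le_mul (mul_le_mul (mul_le_mul_of_nonneg_left h1 hA0) h2 (by positivity)
        (by positivity)) h3t (pow_nonneg hlog0 t) (by positivity)
    calc _ ≤ _ := step
      _ = C₂ * (n ^ ((8 : ℝ) / 10) * n ^ (((d - 1 : ℕ) : ℝ)) * n ^ (δ * t)) := by
          rw [hC₂, Real.rpow_natCast n (d - 1)]
          ring
      _ = C₂ * n ^ ((8 : ℝ) / 10 + ((d - 1 : ℕ) : ℝ) + δ * t) := by
          rw [Real.rpow_add hN0, Real.rpow_add hN0]
      _ ≤ C₂ * n ^ ((d : ℝ) - 1 / 10) :=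
          mul_le_mul_of_nonneg_left (Real.rpow_le_rpow_of_exponent_le hN1 hθ) hC₂0.le
  -- (5) `C₂ n^{d - 1/10} ≤ ε n^d` since `n ≥ (C₂/ε)^{10}`
  have hn10 : C₂ / ε ≤ n ^ ((1 : ℝ) / 10) := by
    have hge : (C₂ / ε) ^ (10 : ℕ) ≤ n := by
      have := Nat.le_ceil ((C₂ / ε) ^ (10 : ℕ))
      have h' : (⌈(C₂ / ε) ^ (10 : ℕ)⌉₊ : ℝ) + 1 ≤ n := by rw [hn]; exact_mod_cast hN
      linarith
    have hpos : 0 ≤ C₂ / ε := by positivity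
    calc C₂ / ε = ((C₂ / ε) ^ (10 : ℕ)) ^ ((1 : ℝ) / 10) := by
          rw [← Real.rpow_natCast, ← Real.rpow_mul hpos]
          norm_num
      _ ≤ n ^ ((1 : ℝ) / 10) := Real.rpow_le_rpow (by positivity) hge (by norm_num)
  calc _ ≤ C₂ * n ^ ((d : ℝ) - 1 / 10) := hLHS
    _ ≤ (ε * n ^ ((1 : ℝ) / 10)) * n ^ ((d : ℝ) - 1 / 10) := by
        refine mul_le_mul_of_nonneg_right ?_ (Real.rpow_nonneg hN0.le _)
        rwa [div_le_iff₀ hε, mul_comm] at hn10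
    _ = ε * (N : ℝ) ^ d := by
        rw [mul_assoc, ← Real.rpow_add hN0, ← Real.rpow_natCast]
        congr 2
        ring

/-! ### Discharge of `GreenTao2010_main_of_mainNormalForm` -/

/-- The bookkeeping of the archimedean reduction, as pure real arithmetic: with
`Σ_K - V S = (Σ_K - Σ_H) + (Σ_H - c_H S) + (c_H - c₀) S + (c₀ - V) S`, the slab bounds
`0 ≤ Σ_K - Σ_H ≤ t H P Λ`, `c_H ≤ c₀ ≤ c_H + t H P`, the lattice count `|c₀ - V| ≤ C_d N^{d-1}`,
`0 ≤ S ≤ B`, and the absorptions `t(1+B), |C_d| B ≤ A`, `H ≤ G`, `N^{d-1} ≤ P`, `Λ ≤ Lg`,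
the total error is at most `|Σ_H - c_H S| + 2 A G P Lg`. [folklore] -/
theorem archimedean_bookkeeping {σK σH cH c0 V S B Cd A G P Lg Λt H t E₁ E₂ Nd : ℝ}
    (hS0 : 0 ≤ S) (hSB : S ≤ B) (hB0 : 0 ≤ B)
    (e1a : 0 ≤ σK - σH) (e1b : σK - σH ≤ t * (H * P) * Λt) (h2 : |σH - cH * S| ≤ E₁)
    (e3 : c0 ≤ cH + t * (H * P)) (e3' : cH ≤ c0) (e4 : |c0 - V| ≤ Cd * Nd) (hNP : Nd ≤ P)
    (hNd : 0 ≤ Nd) (hHG : H ≤ G) (hH0 : 0 ≤ H) (hP0 : 0 ≤ P) (hA0 : 0 ≤ A) (ht0 : 0 ≤ t)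
    (htA : t * (1 + B) ≤ A) (hCdA : |Cd| * B ≤ A) (hΛLg : Λt ≤ Lg) (hLg1 : 1 ≤ Lg)
    (hG1 : 1 ≤ G) (hslab : A * G * P * Lg ≤ E₂) :
    |σK - V * S| ≤ E₁ + 2 * E₂ := by
  have hdecomp : σK - V * S = (σK - σH) + (σH - cH * S) + (cH - c0) * S + (c0 - V) * S := by ring
  have habs : |σK - V * S| ≤ |σK - σH| + |σH - cH * S| + |cH - c0| * S + |c0 - V| * S := by
    rw [hdecomp]
    have h₁ := abs_add_le ((σK - σH) + (σH - cH * S) + (cH - c0) * S) ((c0 - V) * S)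
    have h₂ := abs_add_le ((σK - σH) + (σH - cH * S)) ((cH - c0) * S)
    have h₃ := abs_add_le (σK - σH) (σH - cH * S)
    rw [abs_mul, abs_of_nonneg hS0] at h₁ h₂
    linarith
  have hb1 : |σK - σH| ≤ t * (H * P) * Λt := by rw [abs_of_nonneg e1a]; exact e1b
  have hb3 : |cH - c0| * S ≤ t * (H * P) * S := by
    refine mul_le_mul_of_nonneg_right ?_ hS0
    rw [abs_sub_comm, abs_of_nonneg (by linarith)]
    linarith
  have hb4 : |c0 - V| * S ≤ |Cd| * P * B := by
    calc |c0 - V| * S ≤ (Cd * Nd) * S := mul_le_mul_of_nonneg_right e4 hS0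
      _ ≤ (|Cd| * P) * B := by
          refine mul_le_mul ?_ hSB hS0 (mul_nonneg (abs_nonneg _) hP0)
          calc Cd * Nd ≤ |Cd| * Nd := mul_le_mul_of_nonneg_right (le_abs_self _) hNd
            _ ≤ |Cd| * P := mul_le_mul_of_nonneg_left hNP (abs_nonneg _)
  have hLg0 : 0 ≤ Lg := by linarith
  have hmain1 : t * (H * P) * Λt + t * (H * P) * S ≤ A * G * P * Lg := by
    have h1 : Λt + S ≤ (1 + B) * Lg := by
      have : S ≤ B * Lg := le_trans hSB (le_mul_of_one_le_right hB0 hLg1)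
      linarith
    have htHP : 0 ≤ t * (H * P) := mul_nonneg ht0 (mul_nonneg hH0 hP0)
    calc t * (H * P) * Λt + t * (H * P) * S = t * (H * P) * (Λt + S) := by ring
      _ ≤ t * (H * P) * ((1 + B) * Lg) := mul_le_mul_of_nonneg_left h1 htHP
      _ = (t * (1 + B)) * H * (P * Lg) := by ring
      _ ≤ A * G * (P * Lg) :=
          mul_le_mul_of_nonneg_right (mul_le_mul htA hHG hH0 hA0) (mul_nonneg hP0 hLg0)
      _ = A * G * P * Lg := by ring
  have hmain2 : |Cd| * P * B ≤ A * G * P * Lg := by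
    have hAP : 0 ≤ A * P := mul_nonneg hA0 hP0
    calc |Cd| * P * B = (|Cd| * B) * P := by ring
      _ ≤ A * P := mul_le_mul_of_nonneg_right hCdA hP0
      _ = (A * P) * 1 * 1 := by ring
      _ ≤ (A * P) * G * Lg :=
          mul_le_mul (mul_le_mul_of_nonneg_left hG1 hAP) hLg1 zero_le_one
            (mul_nonneg hAP (by linarith))
      _ = A * G * P * Lg := by ring
  calc |σK - V * S| ≤ |σK - σH| + |σH - cH * S| + |cH - c0| * S + |c0 - V| * S := habs
    _ ≤ t * (H * P) * Λt + E₁ + t * (H * P) * S + |Cd| * P * B :=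
        add_le_add (add_le_add (add_le_add hb1 h2) hb3) hb4
    _ = (t * (H * P) * Λt + t * (H * P) * S) + |Cd| * P * B + E₁ := by ring
    _ ≤ A * G * P * Lg + A * G * P * Lg + E₁ := add_le_add (add_le_add hmain1 hmain2) le_rfl
    _ ≤ E₂ + E₂ + E₁ := add_le_add (add_le_add hslab hslab) le_rfl
    _ = E₁ + 2 * E₂ := by ring

/-- **§4 of Green–Tao 2010, proved**: the level-`s` normal-form statements (the conclusion of
Thm. 4.5) for all `s ≥ 1` imply the generalised Hardy–Littlewood asymptotic for all systems of
finite complexity — the discharge of the named fact `GreenTao2010_main_of_mainNormalForm`. The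
proof is the printed one (see the module docstring for the bookkeeping): elimination of the
archimedean factor (intersect with `Ψ⁻¹((ℝ⁺)ᵗ)`, (1.3)/App. A, boundedness of `∏_p β_p`, the
slab `0 < ψᵢ ≤ N'^{8/10}` estimated crudely), then the normal form extension of Lemma 4.4 with
`β'_p = β_p`, the body `K'`, Thm. 4.5 at scale `N' = (1 + 2t²L) N`, the change of variables
`r := n + ∑ mₗ fₗ` and division by `(2N+1)^{d'-d}`; `s = max(1, t-2)` by Lemma 1.6 and "the case
`s = 0` follows from the `s = 1` case".
[cite: GreenTao2010, §4 (Elimination of the archimedean factor, Thm. 4.1, Lemma 4.4, Proof of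
the Main Theorem assuming Theorem 4.5) and Lemma 1.6] -/
theorem GreenTao2010_main_of_mainNormalForm_holds : GreenTao2010_main_of_mainNormalForm := by
  intro hNF d t L hd ht ε hε
  classical
  -- constants depending only on `d, t, L` (and `ε`)
  obtain ⟨C, hC⟩ : ∃ C : ℕ, C = 1 + t * t * (2 * L) := ⟨_, rfl⟩
  obtain ⟨L', hL'⟩ : ∃ L' : ℕ, L' = t * (d + t * t) * (L + d * L * (2 * L)) + L := ⟨_, rfl⟩
  obtain ⟨B, hB0, hB⟩ := singularProduct_mem_Icc_uniform t L
  obtain ⟨Cd, hCd⟩ := GreenTao2010_latticePointsConvexBody_holds d hd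
  have hC1 : 1 ≤ C := by rw [hC]; exact Nat.le_add_right 1 _
  have hCr1 : (1 : ℝ) ≤ C := by exact_mod_cast hC1
  have hCr0 : (0 : ℝ) < C := by linarith
  have hε' : 0 < ε / (4 * (C : ℝ) ^ (d + t * t)) := by positivity
  obtain ⟨N₁, hN₁⟩ := hNF (max 1 (t - 2)) (le_max_left _ _) (d + t * t) t L'
    (le_trans hd (Nat.le_add_right d _)) ht _ hε'
  obtain ⟨A, hA⟩ : ∃ A : ℝ, A = (C : ℝ) + t * (1 + B) + |Cd| * B + 1 := ⟨_, rfl⟩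
  have htB0 : 0 ≤ (t : ℝ) * (1 + B) := by positivity
  have hCdB0 : 0 ≤ |Cd| * B := by positivity
  have hA1 : 1 ≤ A := by rw [hA]; linarith
  have hA0 : 0 ≤ A := by linarith
  have hCA : (C : ℝ) ≤ A := by rw [hA]; linarith
  have htA : (t : ℝ) * (1 + B) ≤ A := by rw [hA]; linarith
  have hCdA : |Cd| * B ≤ A := by rw [hA]; linarith
  have hL₁ : (1 : ℝ) ≤ max (L : ℝ) 1 := le_max_right _ _
  obtain ⟨N₂, hN₂⟩ := slab_error_eventually hA1 hL₁ (by positivity : 0 < ε / 4) d t hd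
  refine ⟨max N₁ (max N₂ 1), fun N hN Ψ hΨ hfc hL K hK hKN => ?_⟩
  have hN₁N : N₁ ≤ N := le_trans (le_max_left _ _) hN
  have hN₂N : N₂ ≤ N := le_trans ((le_max_left _ _).trans (le_max_right _ _)) hN
  have hN1 : 1 ≤ N := le_trans ((le_max_right _ _).trans (le_max_right _ _)) hN
  have hNr1 : (1 : ℝ) ≤ N := by exact_mod_cast hN1
  have hNr0 : (0 : ℝ) < N := by linarith
  -- coefficient bound and the normal form extension (Lemma 4.4)
  have hcoef : ∀ i j, ((Ψ i).coeff j).natAbs ≤ L := fun i j =>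
    natAbs_coeff_le_of_affLinSize_le hL i j
  obtain ⟨f, hfM, hnf⟩ := GreenTao2010_existsNormalFormExtension Ψ hΨ hfc hcoef
  -- the singular product is bounded
  obtain ⟨hS0, hSB⟩ := hB d Ψ hΨ hfc hcoef
  -- the scale `N' = C N` and the threshold `H = ⌈N'^{8/10}⌉`
  obtain ⟨N', hN'⟩ : ∃ N' : ℕ, N' = C * N := ⟨_, rfl⟩
  have hNN' : N ≤ N' := by rw [hN']; exact Nat.le_mul_of_pos_left N (by omega)
  have hN'r : ((N' : ℕ) : ℝ) = (C : ℝ) * N := by rw [hN']; push_cast; ring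
  obtain ⟨H, hH⟩ : ∃ H : ℕ, H = ⌈((N' : ℕ) : ℝ) ^ ((8 : ℝ) / 10)⌉₊ := ⟨_, rfl⟩
  have hKH : posBody Ψ (H : ℝ) K ⊆ realBox d N := (posBody_subset Ψ _ K).trans hKN
  -- Step 1: Thm. 4.5 for the extension `Ψ'` on the body `K'` at scale `N'`
  have h45 : |vonMangoldtSum (fun i => (Ψ i).extendAlong f) (extBody f (N : ℝ) (posBody Ψ (H : ℝ) K)) N' -
      latticePointCount (extBody f (N : ℝ) (posBody Ψ (H : ℝ) K)) N' *
        singularProduct (fun i => (Ψ i).extendAlong f)| ≤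
      ε / (4 * (C : ℝ) ^ (d + t * t)) * ((N' : ℕ) : ℝ) ^ (d + t * t) := by
    refine hN₁ N' (hN₁N.trans hNN') _ (isNondegenerateSystem_extendAlong hΨ f)
      (hnf.mono (le_max_right _ _)) ?_ _ (convex_extBody f N (convex_posBody Ψ (H : ℝ) hK)) ?_ ?_
    · rw [hL']
      exact affLinSize_extendAlong_le hNr0 (by exact_mod_cast hNN') hL hfM
    · refine extBody_subset_realBox f hfM hNr0.le (le_of_eq ?_) hKH
      rw [hN'r, hC]
      push_cast
      ring
    · intro x hx i
      have hHc : ((N' : ℕ) : ℝ) ^ ((8 : ℝ) / 10) ≤ (H : ℝ) := by rw [hH]; exact Nat.le_ceil _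
      exact lt_of_le_of_lt hHc (extendAlong_realEval_gt_of_mem_extBody f
        (fun y hy j => realEval_gt_of_mem_posBody hy j) hx i)
  -- Step 2: the change of variables `r := n + ∑ mₗ fₗ` and division by `(2N+1)^k`
  have hle : (1 + t * t * (2 * L)) * N ≤ N' := by rw [hN', hC]
  rw [vonMangoldtSum_extendAlong_extBody Ψ f hfM hle hKH, latticePointCount_extBody f hfM hle hKH,
    singularProduct_extendAlong] at h45
  have hQ : (0 : ℝ) < (2 * (N : ℝ) + 1) ^ (t * t) := by positivity
  have h2 : |vonMangoldtSum Ψ (posBody Ψ (H : ℝ) K) N -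
      latticePointCount (posBody Ψ (H : ℝ) K) N * singularProduct Ψ| ≤ ε / 4 * (N : ℝ) ^ d := by
    refine le_of_mul_le_mul_left ?_ hQ
    have hlhs : (2 * (N : ℝ) + 1) ^ (t * t) *
        |vonMangoldtSum Ψ (posBody Ψ (H : ℝ) K) N -
          latticePointCount (posBody Ψ (H : ℝ) K) N * singularProduct Ψ| =
        |(2 * (N : ℝ) + 1) ^ (t * t) * vonMangoldtSum Ψ (posBody Ψ (H : ℝ) K) N -
          (((2 * N + 1) ^ (t * t) * latticePointCount (posBody Ψ (H : ℝ) K) N : ℕ) : ℝ) *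
            singularProduct Ψ| := by
      rw [← abs_of_pos hQ, ← abs_mul, abs_of_pos hQ]
      congr 1
      push_cast
      ring
    rw [hlhs]
    refine h45.trans ?_
    rw [hN'r, mul_pow, pow_add (N : ℝ)]
    have hCpow : (C : ℝ) ^ (d + t * t) ≠ 0 := by positivity
    calc ε / (4 * (C : ℝ) ^ (d + t * t)) * ((C : ℝ) ^ (d + t * t) * ((N : ℝ) ^ d * (N : ℝ) ^ (t * t)))
        = ε / 4 * (N : ℝ) ^ d * (N : ℝ) ^ (t * t) := by
          field_simp
      _ ≤ ε / 4 * (N : ℝ) ^ d * (2 * (N : ℝ) + 1) ^ (t * t) :=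
          mul_le_mul_of_nonneg_left (pow_le_pow_left₀ hNr0.le (by linarith) _) (by positivity)
      _ = (2 * (N : ℝ) + 1) ^ (t * t) * (ε / 4 * (N : ℝ) ^ d) := by ring
  -- Step 3: the crude bounds (slab `0 < ψᵢ ≤ H`, lattice points vs volume)
  have e1 := vonMangoldtSum_sub_posBody_le hΨ hN1 hL₁ (hL.trans (le_max_left _ _)) K H
  have e3 : (latticePointCount (posBody Ψ 0 K) N : ℝ) ≤
      latticePointCount (posBody Ψ (H : ℝ) K) N + t * ((H : ℝ) * (2 * N + 1) ^ (d - 1)) := by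
    exact_mod_cast latticePointCount_posBody_le hΨ K N H
  have e3' : (latticePointCount (posBody Ψ (H : ℝ) K) N : ℝ) ≤
      latticePointCount (posBody Ψ 0 K) N := by
    exact_mod_cast latticePointCount_mono (posBody_mono Ψ (Nat.cast_nonneg H) K) N
  have e4 : |(latticePointCount (posBody Ψ 0 K) N : ℝ) - archFactor Ψ K| ≤ Cd * (N : ℝ) ^ (d - 1) :=
    hCd N hN1 (posBody Ψ 0 K) (convex_posBody Ψ 0 hK) ((posBody_subset Ψ 0 K).trans hKN)
  have hslab := hN₂ N hN₂N
  have hHG : (H : ℝ) ≤ (A * N) ^ ((8 : ℝ) / 10) + 1 := by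
    have h1 : (H : ℝ) < ((N' : ℕ) : ℝ) ^ ((8 : ℝ) / 10) + 1 := by
      rw [hH]
      exact Nat.ceil_lt_add_one (by positivity)
    have h2 : ((N' : ℕ) : ℝ) ^ ((8 : ℝ) / 10) ≤ (A * N) ^ ((8 : ℝ) / 10) := by
      refine Real.rpow_le_rpow (by positivity) ?_ (by norm_num)
      rw [hN'r]
      exact mul_le_mul_of_nonneg_right hCA hNr0.le
    linarith
  -- Step 4: bookkeeping
  have h2LN : (1 : ℝ) ≤ 2 * max (L : ℝ) 1 * N := by
    have := one_le_mul_of_one_le_of_one_le hL₁ hNr1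
    linarith
  have hlog0 : 0 ≤ Real.log (2 * max (L : ℝ) 1 * N) := Real.log_nonneg h2LN
  have hΛLg : Real.log (2 * max (L : ℝ) 1 * N) ^ t ≤ (1 + Real.log (2 * max (L : ℝ) 1 * N)) ^ t :=
    pow_le_pow_left₀ hlog0 (by linarith) t
  have hLg1 : 1 ≤ (1 + Real.log (2 * max (L : ℝ) 1 * N)) ^ t := one_le_pow₀ (by linarith)
  have hG1 : 1 ≤ (A * N) ^ ((8 : ℝ) / 10) + 1 := by
    have : 0 ≤ (A * N) ^ ((8 : ℝ) / 10) := Real.rpow_nonneg (by positivity) _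
    linarith
  have hNP : (N : ℝ) ^ (d - 1) ≤ (2 * (N : ℝ) + 1) ^ (d - 1) :=
    pow_le_pow_left₀ hNr0.le (by linarith) _
  have hεN : 0 ≤ ε * (N : ℝ) ^ d := by positivity
  have key := archimedean_bookkeeping hS0 hSB hB0 e1.1 e1.2 h2 e3 e3' e4 hNP (by positivity) hHG
    (Nat.cast_nonneg H) (by positivity) hA0 (Nat.cast_nonneg t) htA hCdA hΛLg hLg1 hG1 hslab
  linarith

/-! ### Assembly: what is left of the transference -/

/-- With §4 discharged, the transference `GreenTao2010_transference` (Thm. 7.2 for all `s ≥ 1`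
implies the Main Theorem for systems of finite complexity) follows from the two remaining
printed reductions: §5 (Thm. 4.5 from Thm. 5.1, the `W`-trick) and §7 (Thm. 5.2 from Thm. 7.2
via Props. 6.4 and 7.1). [cite: GreenTao2010, §§4–7] -/
theorem GreenTao2010_transference_of_wTricked (h₂ : GreenTao2010_mainNormalForm_of_wTricked)
    (h₃ : GreenTao2010_wTrickedProduct_of_gowersUniformity) : GreenTao2010_transference :=
  GreenTao2010_transference_of_reductions GreenTao2010_main_of_mainNormalForm_holds h₂ h₃

/-- Assembly down to this layer: the reductions of §5 and §7 and the Gowers uniformity estimate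
Thm. 7.2 (with `GI(s)` from Green–Tao–Ziegler 2012 and `MN(s)` from Green–Tao 2012) give the
Green–Tao–Ziegler theorem. [cite: GreenTao2010, Main Theorem]
[cite: GreenTaoZiegler2012, Thm. 1.3 and the following paragraph] -/
theorem GreenTaoZiegler2012_finiteComplexity_of_wTricked
    (h₂ : GreenTao2010_mainNormalForm_of_wTricked)
    (h₃ : GreenTao2010_wTrickedProduct_of_gowersUniformity)
    (hU : GreenTao2010_gowersUniformity) : GreenTaoZiegler2012_finiteComplexity :=
  GreenTaoZiegler2012_finiteComplexity_of_transference (GreenTao2010_transference_of_wTricked h₂ h₃)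
    hU

end Literature.NumberTheory.Sieve
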